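import Summits.MatrixMultiplication.MatrixMultiplication.Theses.SaturationLadder
import Summits.MatrixMultiplication.MatrixMultiplication.Theorems.SaturationLadderExpSaturation
import HarnessLib

/-!
# SaturationLadder — the TWIN RUNG `TwinSaturation` (stmt-MatrixMultiplication-30539) is sandwiched

Route `Summits/MatrixMultiplication/MatrixMultiplication/Theses/SaturationLadder.lean` (rev 6), leaf
`SubexpSaturation` (stmt-MatrixMultiplication-25909, crux r2) and its typed rung `TwinSaturation`
(stmt-MatrixMultiplication-30539, aside r9: exact far tightness from `r = O(3^{1/(1−t)})` on).

Two short real-analysis facts placing the rung on the ladder (decomp-mm lens-1, generation 8):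

* `twinSaturation_of_subexpSaturation : SubexpSaturation → TwinSaturation` — the clause `c = log 3` of
  the crux gives the budget `3^{1/(1−t)}` beyond some `t₀ < 1`; below `t₀` one witness `r(t₀)` serves every
  smaller `t` by monotonicity of `ω(1,·,r)` (`omegaRect_mono'`), and the constant `C := r(t₀)` absorbs it.
* `subexpSaturation_clause_of_twinSaturation : TwinSaturation → ∀ c > log 3, <clause c of SubexpSaturation>`
  — `C · 3^{1/(1−t)} ≤ e^{c/(1−t)}` as soon as `(1−t) log (max C 3) ≤ c − log 3`.

So `SubexpSaturation ⟹ TwinSaturation ⟹ (every clause c > log 3)`, strictly extending the landed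
`subexpSaturation_above_log_four` (base `4`, from `ExpSaturation`) once `TwinSaturation` is proved; the rung's
evidence (the twin Coppersmith–Winograd family, onset constant `(5 log 5 − 7 log 2)/3 ≈ 1.065 < log 3`) and
its base tensor are in `Theorems/SaturationLadderTwinCW.lean`.
-/

set_option linter.dupNamespace false

namespace Summit.MatrixMultiplication.MatrixMultiplication.Theorems.SaturationLadderTwinRung

open Literature.Computability.AlgebraicComplexity
open Summit.MatrixMultiplication.MatrixMultiplication.Theses.SaturationLadder
open Summit.MatrixMultiplication.MatrixMultiplication.Theorems.SaturationLadderExpSaturation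

/-- `exp (log 3 / (1 - t)) = 3 ^ (1 / (1 - t))`. [folklore] -/
theorem exp_log_three_div (t : ℝ) :
    Real.exp (Real.log 3 / (1 - t)) = (3 : ℝ) ^ (1 / (1 - t)) := by
  rw [Real.rpow_def_of_pos (by norm_num : (0 : ℝ) < 3), div_eq_mul_one_div]

/-- **The crux implies the rung**: `SubexpSaturation → TwinSaturation`.  The clause `c = log 3` gives
`t₀ < 1` beyond which `r ≤ e^{log 3/(1−t)} = 3^{1/(1−t)}` works; for `t < t₁ := max 0 t₀` the single
witness `r₁ := r(t₁)` works by monotonicity in the middle slot, and `C := r₁ ≥ 1` covers both ranges.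
[folklore] -/
theorem twinSaturation_of_subexpSaturation (h : SubexpSaturation) : TwinSaturation := by
  obtain ⟨t₀, ht₀, H⟩ := h (Real.log 3) (Real.log_pos (by norm_num))
  set t₁ : ℝ := max 0 t₀ with ht₁_def
  have ht₁0 : 0 ≤ t₁ := le_max_left _ _
  have ht₁1 : t₁ < 1 := max_lt one_pos ht₀
  obtain ⟨r₁, hr₁, -, hT₁⟩ := H t₁ (le_max_right _ _) ht₁1
  refine ⟨r₁, fun t ht0 ht1 => ?_⟩
  have hpow : 1 ≤ (3 : ℝ) ^ (1 / (1 - t)) :=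
    Real.one_le_rpow (by norm_num) (div_nonneg zero_le_one (by linarith))
  by_cases hlt : t < t₁
  · -- below `t₁`: the witness at `t₁` serves, by monotonicity of `ω(1,·,r₁)`
    refine ⟨r₁, hr₁, ?_, (omegaRect_mono' le_rfl hlt.le le_rfl).trans hT₁⟩
    calc r₁ = r₁ * 1 := (mul_one _).symm
      _ ≤ r₁ * (3 : ℝ) ^ (1 / (1 - t)) := mul_le_mul_of_nonneg_left hpow (by linarith)
  · -- from `t₁` on: the clause `c = log 3` itself
    obtain ⟨r, hr, hrle, hT⟩ := H t (le_trans (le_max_right _ _) (not_lt.mp hlt)) ht1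
    refine ⟨r, hr, ?_, hT⟩
    rw [exp_log_three_div] at hrle
    calc r ≤ (3 : ℝ) ^ (1 / (1 - t)) := hrle
      _ = 1 * (3 : ℝ) ^ (1 / (1 - t)) := (one_mul _).symm
      _ ≤ r₁ * (3 : ℝ) ^ (1 / (1 - t)) := mul_le_mul_of_nonneg_right hr₁ (by linarith)

/-- **The rung implies every clause `c > log 3` of the crux**: from `TwinSaturation`, for `c > log 3`
there is `t₀ < 1` with `r ≤ e^{c/(1−t)}` tight for all `t ∈ [t₀, 1)` — since
`C · 3^{1/(1−t)} ≤ (max C 3) · 3^{1/(1−t)} = e^{K + log 3/(1−t)} ≤ e^{c/(1−t)}` once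
`(1 − t) K ≤ c − log 3`, `K := log (max C 3) > 0`. [folklore] -/
theorem subexpSaturation_clause_of_twinSaturation (h : TwinSaturation) (c : ℝ) (hc : Real.log 3 < c) :
    ∃ t₀ : ℝ, t₀ < 1 ∧ ∀ t : ℝ, t₀ ≤ t → t < 1 →
      ∃ r : ℝ, 1 ≤ r ∧ r ≤ Real.exp (c / (1 - t)) ∧ omegaRect ℂ 1 t r ≤ 1 + r := by
  obtain ⟨C, H⟩ := h
  set M : ℝ := max C 3 with hM_def
  have hM3 : (3 : ℝ) ≤ M := le_max_right _ _
  have hMpos : 0 < M := lt_of_lt_of_le (by norm_num) hM3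
  have hK : 0 < Real.log M := Real.log_pos (lt_of_lt_of_le (by norm_num) hM3)
  refine ⟨max 0 (1 - (c - Real.log 3) / Real.log M), ?_, ?_⟩
  · refine max_lt one_pos ?_
    have : 0 < (c - Real.log 3) / Real.log M := div_pos (by linarith) hK
    linarith
  · intro t ht0 ht1
    have ht0' : 0 ≤ t := le_trans (le_max_left _ _) ht0
    have ht2 : 1 - (c - Real.log 3) / Real.log M ≤ t := le_trans (le_max_right _ _) ht0
    have h1t : 0 < 1 - t := by linarith
    obtain ⟨r, hr1, hrle, hT⟩ := H t ht0' ht1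
    refine ⟨r, hr1, hrle.trans ?_, hT⟩
    have hpow : 0 < (3 : ℝ) ^ (1 / (1 - t)) := Real.rpow_pos_of_pos (by norm_num) _
    -- `C · 3^{1/(1−t)} ≤ M · 3^{1/(1−t)} = exp (log M + log 3 · (1/(1−t)))`
    have step1 : C * (3 : ℝ) ^ (1 / (1 - t)) ≤ M * (3 : ℝ) ^ (1 / (1 - t)) :=
      mul_le_mul_of_nonneg_right (le_max_left _ _) hpow.le
    refine step1.trans ?_
    have e : M * (3 : ℝ) ^ (1 / (1 - t)) =
        Real.exp (Real.log M + Real.log 3 * (1 / (1 - t))) := by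
      rw [Real.exp_add, Real.exp_log hMpos, Real.rpow_def_of_pos (by norm_num : (0 : ℝ) < 3)]
    rw [e, Real.exp_le_exp]
    have key : (1 - t) * Real.log M ≤ c - Real.log 3 := by
      have h' : 1 - t ≤ (c - Real.log 3) / Real.log M := by linarith
      rw [le_div_iff₀ hK] at h'
      linarith
    rw [← sub_nonneg]
    have e2 : c / (1 - t) - (Real.log M + Real.log 3 * (1 / (1 - t))) =
        ((c - Real.log 3) - (1 - t) * Real.log M) / (1 - t) := by
      field_simp
      ring
    rw [e2]
    exact div_nonneg (by linarith) h1t.le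

/-- Sanity (the other half of the sandwich is trivial): the crux gives the same clauses outright,
`SubexpSaturation` being `∀ c > 0`. [folklore] -/
theorem subexpSaturation_clause_of_gt_log_three (h : SubexpSaturation) (c : ℝ) (hc : Real.log 3 < c) :
    ∃ t₀ : ℝ, t₀ < 1 ∧ ∀ t : ℝ, t₀ ≤ t → t < 1 →
      ∃ r : ℝ, 1 ≤ r ∧ r ≤ Real.exp (c / (1 - t)) ∧ omegaRect ℂ 1 t r ≤ 1 + r :=
  h c (lt_trans (Real.log_pos (by norm_num)) hc)

/-- The landed base-`4` rung is the `C = 16` instance of the base-`4` analogue; recorded for comparison: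
`ExpSaturation` gives a `TwinSaturation`-shaped statement with base `4`. [folklore] -/
theorem expSaturation_shape :
    ∃ C : ℝ, ∀ t : ℝ, 0 ≤ t → t < 1 →
      ∃ r : ℝ, 1 ≤ r ∧ r ≤ C * (4 : ℝ) ^ (1 / (1 - t)) ∧ omegaRect ℂ 1 t r ≤ 1 + r :=
  ⟨16, expSaturation_holds⟩

end Summit.MatrixMultiplication.MatrixMultiplication.Theorems.SaturationLadderTwinRung
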